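import Summits.HodgeConjecture.HodgeConjecture.Theorems.SecondaryPeriodsHodgeImpliesConiveauOne
import Summits.HodgeConjecture.HodgeConjecture.Theorems.SecondaryPeriodsConiveauOneFailureStubSurfaceGysin
import Summits.HodgeConjecture.HodgeConjecture.Theorems.SecondaryPeriodsConiveauOneFailureStubCurveOnSurface
import Summits.HodgeConjecture.HodgeConjecture.Theorems.SecondaryPeriodsConiveauOneFailureStubHodgeSplitting
import Summits.HodgeConjecture.HodgeConjecture.Theorems.SecondaryPeriodsConiveauOneFailureStubAlgebraicSplitting
import Summits.HodgeConjecture.HodgeConjecture.Theorems.SecondaryPeriodsConiveauOneFailureStubGysinCompCorrAction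

/-!
# Route `SecondaryPeriods`, crux `ConiveauOneFailure` (stmt-HodgeConjecture-3540): the TRANSFER of
# coniveau one to the cycle side of the fourfolds `Y × C` (Grothendieck's reformulation, proved)

For a smooth projective threefold `Y/ℂ`, Grothendieck (Topology 8 (1969), p. 301) observed that a
class of `H³(Y)` is supported on a divisor iff it lies in the image of an algebraic correspondence
from `H¹` of a curve. This file proves that reformulation on the tree's carriers, UNCONDITIONALLY,
by assembling the five landed transfer stubs of the birth line of the crux:

* `supportedClasses_le_iSup_range_curveCorrespondences` — **`N¹H³(Y)` is carried by finitely many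
  algebraic curve correspondences**: there are finitely many smooth projective curves `C_j` and
  linear maps `T_j : H¹(C_j(ℂ); ℂ) → H³(Y(ℂ); ℂ)`, each induced by an algebraic correspondence
  (`IsAlgebraicCorrespondence 3 1 Y (C j) (T j)`: the action of an algebraic codimension-2 class on
  the fourfold `Y ⊗ C_j`), with `N¹H³(Y) ⊆ Σ_j im T_j`. Chain: Deligne, Hodge III Cor. 8.2.8 puts
  `N¹H³(Y)` in finitely many Gysin images `g_{j*} H¹(S_j)` of smooth projective surfaces
  (`stub_supportedClasses_le_surfaceGysin`); every surface carries a curve `i_j : C_j → S_j` with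
  `i_j^*` injective on `H¹` (weak Lefschetz for a smooth pencil member,
  `stub_curveOnSurface_injective`); polarisable weight-one Hodge structures being semisimple,
  `i_j^*` is split by a surjective Hodge map `H¹(C_j) ↠ H¹(S_j)` (`stub_surjective_hodgeMap_of_injective`),
  which by Voisin I Lemma 11.41 and Lefschetz (1,1) is the action of an algebraic divisor class
  `γ_j` on `S_j ⊗ C_j` up to a scalar (`stub_surjective_algebraic_corrAction_of_hodgeMap`); and
  `g_{j*} ∘ [γ_j]_* = [(g_j ⊗ 𝟙)_* γ_j]_*` is again algebraic
  (`stub_isAlgebraicCorrespondence_gysin_comp_corrAction`).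
* `range_le_supportedClasses_of_isAlgebraicCorrespondence_curve` — conversely the image of an
  algebraic curve correspondence `H¹(C) → H³(Y)` lies in `N¹H³(Y)` (cup product with a class
  supported in codimension `2` is supported in codimension `2`; the Gysin morphism of
  `pr_Y : Y ⊗ C → Y` lowers the codimension of supports by the relative dimension `1`).
* `le_supportedClasses_iff_exists_curveCorrespondences` — hence for every `V ⊆ H³(Y(ℂ); ℂ)`:
  `V ⊆ N¹H³(Y)` **iff** `V` is carried by finitely many algebraic curve correspondences.
* `coniveauOneFailure_iff_exists_offCurveCorrespondences` — the crux
  `ConiveauOneFailure = ¬ LevelOneConiveauThreefolds` (¬GHC(3,1) for threefolds) is EQUIVALENT to: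
  some smooth projective threefold carries a rational level-one sub-Hodge structure of `H³` (the
  crux's binders verbatim) that NO finite family of algebraic curve correspondences carries — the
  cycle-side form on which the route's instrument (secondary periods = Abel–Jacobi invariants of
  codimension-2 cycles on `Y × C`) operates; and `coniveauOneFailure_of_heart` — the birth line's
  heart (the same at a Calabi–Yau-type threefold with a rank-2 plane) implies the crux.

What is NOT here: the heart itself (an attractor plane carried by no curve correspondence) — the
open problem the crux consists of after this transfer.

## References

* [GrothendieckTopology1969] A. Grothendieck, Hodge's general conjecture is false for trivial
  reasons, Topology 8 (1969), p. 301 (footnote: coniveau one via correspondences from curves).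
* [DeligneHodgeIII1974] P. Deligne, Théorie de Hodge III, Publ. Math. IHÉS 44 (1974), Cor. 8.2.8.
* [VoisinHodgeI2002] C. Voisin, Hodge Theory and Complex Algebraic Geometry I, §7.3.1 Lemma 7.26,
  §11.3.3 Lemma 11.41, Thm. 11.30.
* [VoisinHodgeII2003] C. Voisin, Hodge Theory and Complex Algebraic Geometry II, Thm. 1.23, §2.1.1.
* [KerrPearlstein2016] M. Kerr, G. Pearlstein (eds.), Recent Advances in Hodge Theory, Ch. 11
  (S. Abdulali), §1 p. 288.
-/

noncomputable section

-- every declaration of this problem lives in `Summit.HodgeConjecture.HodgeConjecture.…` (summit = sub-problem), which `linter.dupNamespace` flags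
set_option linter.dupNamespace false

namespace Summit.HodgeConjecture.HodgeConjecture.Theorems

open CategoryTheory MonoidalCategory CartesianMonoidalCategory
open Literature.AlgebraicGeometry.Motives Literature.AlgebraicGeometry.HodgeTheory
  Literature.AlgebraicTopology.SingularHomology
open Summit.HodgeConjecture.HodgeConjecture.Theses.SecondaryPeriods (LevelOneConiveauThreefolds
  ConiveauOneFailure)

/-! ### Forward: `N¹H³(Y)` is carried by finitely many algebraic curve correspondences -/

/-- **Coniveau-one classes of a smooth projective threefold are carried by finitely many algebraic
curve correspondences** (Grothendieck's reformulation, forward direction): for `Y/ℂ` smooth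
projective of dimension `3` there are finitely many smooth projective curves `C_j` and algebraic
correspondences `T_j : H¹(C_j(ℂ); ℂ) → H³(Y(ℂ); ℂ)` (actions of codimension-2 algebraic classes on
the fourfolds `Y ⊗ C_j`) with `N¹H³(Y) ⊆ Σ_j im T_j`. Assembled from the five transfer stubs of the
birth line of `ConiveauOneFailure` (Deligne Hodge III Cor. 8.2.8 → curve on each surface, weak
Lefschetz → semisimplicity of polarisable weight-one Hodge structures → Voisin I Lemma 11.41 +
Lefschetz (1,1) → Gysin ∘ correspondence is a correspondence); `im g_{j*} = im (g_{j*} ∘ [γ_j]_*)`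
because `[γ_j]_*` is onto. [cite: GrothendieckTopology1969, p. 301]
[cite: DeligneHodgeIII1974, Cor. 8.2.8] [cite: VoisinHodgeI2002, §11.3.3 Lemma 11.41] -/
theorem supportedClasses_le_iSup_range_curveCorrespondences :
    ∀ ⦃Y : SchemeOver ℂ⦄ (hY : IsSmoothProjective 3 Y),
      ∃ (ι : Type) (_ : Finite ι) (C : ι → SchemeOver ℂ) (_ : ∀ j, IsSmoothProjective 1 (C j))
        (T : ∀ j, complexBetti (C j) 1 →ₗ[ℂ] complexBetti Y 3),
        (∀ j, IsAlgebraicCorrespondence 3 1 Y (C j) (T j)) ∧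
          supportedClasses Y 3 1 ≤ ⨆ j, LinearMap.range (T j) := by
  intro Y hY
  obtain ⟨μ, ι, hι, S, hS, g, hle⟩ := stub_supportedClasses_le_surfaceGysin hY
  choose C hC i hi using fun j ↦ stub_curveOnSurface_injective (hS j)
  choose A B φ hφ hφH hφsurj using fun j ↦ stub_surjective_hodgeMap_of_injective (hS j) (hC j) (i j) (hi j)
  choose γ hγ hsurj using fun j ↦
    stub_surjective_algebraic_corrAction_of_hodgeMap (hS j) (hC j) (A j) (B j) (φ j) (hφ j) (hφH j)
      (hφsurj j) μ
  refine ⟨ι, hι, C, hC, fun j ↦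
    complexGysin μ (hS j) hY (g j) (show 1 + 2 * 3 = 3 + 2 * 2 by norm_num) ∘ₗ
      corrAction μ (hS j) (hC j) (show 1 + 2 * 1 = 1 + 2 * 1 from rfl) (γ j),
    fun j ↦ stub_isAlgebraicCorrespondence_gysin_comp_corrAction μ hY (hS j) (hC j) (g j) (γ j) (hγ j),
    hle.trans (iSup_mono fun j ↦ ?_)⟩
  rw [LinearMap.range_comp_of_range_eq_top _ (LinearMap.range_eq_top.2 (hsurj j))]

/-! ### Converse: algebraic curve correspondences land in `N¹H³(Y)` -/

/-- **The image of an algebraic curve correspondence `H¹(C(ℂ)) → H³(Y(ℂ))` lies in `N¹H³(Y)`**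
(Grothendieck's observation for the curve source): for `T = [γ]_* = pr_{Y*}(pr_C^*(·) ∪ γ)` with
`γ ∈ N²H⁴((Y ⊗ C)(ℂ))`, `pr_C^* c ∪ γ ∈ N²H⁵` (`cupProduct_mem_supportedClasses_right`) and the
Gysin map of `pr_Y : Y ⊗ C → Y` (relative dimension `1`) lowers the codimension of supports by one
(`gysinMap_mem_supportedClasses_of_isSmoothProjective`). [cite: GrothendieckTopology1969, p. 301]
[cite: FultonYoungTableaux1997, Appendix B §B.2 Exercise 5] -/
theorem range_le_supportedClasses_of_isAlgebraicCorrespondence_curve {Y C : SchemeOver ℂ}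
    (hY : IsSmoothProjective 3 Y) (hC : IsSmoothProjective 1 C)
    {T : complexBetti C 1 →ₗ[ℂ] complexBetti Y 3} (hT : IsAlgebraicCorrespondence 3 1 Y C T) :
    LinearMap.range T ≤ supportedClasses Y 3 1 := by
  obtain ⟨μ, ν, -, hν, e, q, hab, hq, γ, hγ, rfl⟩ := hT
  rintro _ ⟨c, rfl⟩
  obtain rfl : e = 2 := by omega
  obtain rfl : q = 3 := by omega
  rw [corrClassAction_apply]
  exact gysinMap_mem_supportedClasses_of_isSmoothProjective (IsSmoothProjective.tensor_holds hY hC)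
    hY μ ν hν (fst Y C) _ hq (show 1 + (3 + 1) ≤ 3 + 2 by norm_num)
    (cupProduct_mem_supportedClasses_right rfl _ hγ)

/-- **A finite family of algebraic curve correspondences carries only coniveau-one classes**: the
sum of their images lies in `N¹H³(Y)`. [cite: GrothendieckTopology1969, p. 301] -/
theorem iSup_range_le_supportedClasses_of_isAlgebraicCorrespondence_curve {Y : SchemeOver ℂ}
    (hY : IsSmoothProjective 3 Y) {ι : Type} {C : ι → SchemeOver ℂ}
    (hC : ∀ j, IsSmoothProjective 1 (C j)) {T : ∀ j, complexBetti (C j) 1 →ₗ[ℂ] complexBetti Y 3}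
    (hT : ∀ j, IsAlgebraicCorrespondence 3 1 Y (C j) (T j)) :
    ⨆ j, LinearMap.range (T j) ≤ supportedClasses Y 3 1 :=
  iSup_le fun j ↦ range_le_supportedClasses_of_isAlgebraicCorrespondence_curve hY (hC j) (hT j)

/-! ### Grothendieck's reformulation as an equivalence, and the crux on the cycle side -/

/-- **Grothendieck's reformulation of coniveau one for `H³` of a threefold (PROVED equivalence)**:
for `Y/ℂ` smooth projective of dimension `3` and any `V ⊆ H³(Y(ℂ); ℂ)`, `V ⊆ N¹H³(Y)` iff `V` is
carried by finitely many algebraic correspondences from `H¹` of smooth projective curves, i.e. by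
codimension-2 algebraic classes on fourfolds `Y ⊗ C_j` ("the image of `H¹(C)` under an algebraic
correspondence", Topology 8, p. 301). [cite: GrothendieckTopology1969, p. 301]
[cite: KerrPearlstein2016, Ch. 11 (Abdulali) §1 p. 288] -/
theorem le_supportedClasses_iff_exists_curveCorrespondences {Y : SchemeOver ℂ}
    (hY : IsSmoothProjective 3 Y) (V : Submodule ℂ (complexBetti Y 3)) :
    V ≤ supportedClasses Y 3 1 ↔
      ∃ (ι : Type) (_ : Finite ι) (C : ι → SchemeOver ℂ) (_ : ∀ j, IsSmoothProjective 1 (C j))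
        (T : ∀ j, complexBetti (C j) 1 →ₗ[ℂ] complexBetti Y 3),
        (∀ j, IsAlgebraicCorrespondence 3 1 Y (C j) (T j)) ∧ V ≤ ⨆ j, LinearMap.range (T j) := by
  constructor
  · intro hV
    obtain ⟨ι, hι, C, hC, T, hT, hle⟩ := supportedClasses_le_iSup_range_curveCorrespondences hY
    exact ⟨ι, hι, C, hC, T, hT, hV.trans hle⟩
  · rintro ⟨ι, -, C, hC, T, hT, hle⟩
    exact hle.trans (iSup_range_le_supportedClasses_of_isAlgebraicCorrespondence_curve hY hC hT)

/-- **The crux `ConiveauOneFailure` on the cycle side (PROVED equivalence).** GHC(3,1) fails for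
some smooth projective threefold (`ConiveauOneFailure = ¬ LevelOneConiveauThreefolds`,
stmt-HodgeConjecture-3540) **iff** some smooth projective threefold `Y` carries a finite set `s` of
rational classes of `H³(Y(ℂ))` whose span is a sub-Hodge structure of level one (the crux's binders
verbatim: stable under the type decomposition of a Hodge model `A`, contained in
`H^{2,1} ⊕ H^{1,2}`) that NO finite family of algebraic curve correspondences
`T_j : H¹(C_j(ℂ)) → H³(Y(ℂ))` carries. This is the form on which the route's instrument operates
(secondary periods: Abel–Jacobi invariants of codimension-2 cycles on `Y × C`); the remaining
content of the crux is the existence of such a witness (open). [cite: GrothendieckTopology1969, p. 301] -/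
theorem coniveauOneFailure_iff_exists_offCurveCorrespondences :
    ConiveauOneFailure ↔
      ∃ (Y : SchemeOver ℂ) (_ : IsSmoothProjective 3 Y) (A : HodgeModel 3 Y)
        (s : Finset (complexBetti Y 3)),
        (∀ c ∈ s, IsRationalClass c) ∧
        (Submodule.span ℂ (↑s : Set (complexBetti Y 3))).map (A.pullback 3).hom =
          (⨆ (p : ℕ) (q : ℕ) (_ : p + q = 3),
            (Submodule.span ℂ (↑s : Set (complexBetti Y 3))).map (A.pullback 3).hom ⊓
              A.hodgePQ 3 p q) ∧
        (Submodule.span ℂ (↑s : Set (complexBetti Y 3))).map (A.pullback 3).hom ≤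
          (⨆ (p : ℕ) (q : ℕ) (_ : p + q = 3) (_ : 1 ≤ p) (_ : 1 ≤ q), A.hodgePQ 3 p q) ∧
        ¬ ∃ (ι : Type) (_ : Finite ι) (C : ι → SchemeOver ℂ) (_ : ∀ j, IsSmoothProjective 1 (C j))
            (T : ∀ j, complexBetti (C j) 1 →ₗ[ℂ] complexBetti Y 3),
            (∀ j, IsAlgebraicCorrespondence 3 1 Y (C j) (T j)) ∧
              Submodule.span ℂ (↑s : Set (complexBetti Y 3)) ≤ ⨆ j, LinearMap.range (T j) := by
  constructor
  · intro h
    by_contra hne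
    refine h fun Y hY A s hs hsub hlev ↦ ?_
    by_contra hV
    exact hne ⟨Y, hY, A, s, hs, hsub, hlev, fun hcar ↦
      hV ((le_supportedClasses_iff_exists_curveCorrespondences hY _).2 hcar)⟩
  · rintro ⟨Y, hY, A, s, hs, hsub, hlev, hoff⟩ hG
    exact hoff ((le_supportedClasses_iff_exists_curveCorrespondences hY _).1
      (hG hY A s hs hsub hlev))

/-- **The birth line's heart implies the crux (PROVED composition).** If some smooth projective
threefold of Calabi–Yau type (`h^{3,0} = 1`) carries a rational rank-2 level-one sub-Hodge structure
of `H³` ("attractor plane") that no finite family of algebraic curve correspondences carries, then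
GHC(3,1) fails (`ConiveauOneFailure`). The two extra conditions only restrict the habitat; the
converse holds without them (`coniveauOneFailure_iff_exists_offCurveCorrespondences`).
[cite: GrothendieckTopology1969, p. 301] [cite: CandelasEtAl2020, §6] [cite: BonischEtAl2024, §3.3] -/
theorem coniveauOneFailure_of_heart
    (h : ∃ (Y : SchemeOver ℂ) (_ : IsSmoothProjective 3 Y) (A : HodgeModel 3 Y)
      (s : Finset (complexBetti Y 3)),
      (∀ c ∈ s, IsRationalClass c) ∧
      (Submodule.span ℂ (↑s : Set (complexBetti Y 3))).map (A.pullback 3).hom =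
        (⨆ (p : ℕ) (q : ℕ) (_ : p + q = 3),
          (Submodule.span ℂ (↑s : Set (complexBetti Y 3))).map (A.pullback 3).hom ⊓
            A.hodgePQ 3 p q) ∧
      (Submodule.span ℂ (↑s : Set (complexBetti Y 3))).map (A.pullback 3).hom ≤
        (⨆ (p : ℕ) (q : ℕ) (_ : p + q = 3) (_ : 1 ≤ p) (_ : 1 ≤ q), A.hodgePQ 3 p q) ∧
      Module.finrank ℂ (A.hodgePQ 3 3 0) = 1 ∧
      Module.finrank ℂ (Submodule.span ℂ (↑s : Set (complexBetti Y 3))) = 2 ∧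
      ¬ ∃ (ι : Type) (_ : Finite ι) (C : ι → SchemeOver ℂ) (_ : ∀ j, IsSmoothProjective 1 (C j))
          (T : ∀ j, complexBetti (C j) 1 →ₗ[ℂ] complexBetti Y 3),
          (∀ j, IsAlgebraicCorrespondence 3 1 Y (C j) (T j)) ∧
            Submodule.span ℂ (↑s : Set (complexBetti Y 3)) ≤ ⨆ j, LinearMap.range (T j)) :
    ConiveauOneFailure := by
  obtain ⟨Y, hY, A, s, hs, hsub, hlev, -, -, hoff⟩ := h
  exact coniveauOneFailure_iff_exists_offCurveCorrespondences.2 ⟨Y, hY, A, s, hs, hsub, hlev, hoff⟩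

end Summit.HodgeConjecture.HodgeConjecture.Theorems

end
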